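import Summits.QuantumFields.BalabanUV.T4Continuum.Support.ShellMeasureRootCompositionToy

/-!
# `T4Continuum.ShellMeasureRootCompositionNecessity` — END-I's DISPLAYED BINDERS ARE EACH LOAD-BEARING, AND THE
# RATE BINDER IS SHARP: on one-term ∕ one-slot-per-level models every binder KIND of
# `ShellMeasureRootComposition.shellWeightBound_of_slotAC` but one is inhabited while `ShellWeightBound` FAILS for
# EVERY `Wsh`; on the uniform one-slot model `(∃ Wsh, ShellWeightBound …) ↔ Summable ρ`
(cell `pub-balaban`, sub-cell `t4`, spine estimate NE7c (node U5b); NE7c ROUND-2 crew `t4-ne7c-formalise-*` under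
`t4/T4-NE7c-TRIGGER.json`, row S54 of the claim table `t4/b2b-balaban-t4-ne7c-p1/LEAVES-NE7c-P1.md` (owner booking
v2.2, journal `CLAIMS.log` l.13499: «census file, NOT of record for the countdown»), seat
`b2b-balaban-t4-ne7c-formalise-leaf-01` (gen 4); file 1∕2 (OFFER l.13325) = the NECESSITY companion of this seat's row S10 `ShellMeasureRootCompositionToy` (p207982 ∕
p216637: JOINT INHABITATION of END-I's binder list); ADDITIVE — imports S10 (hence S7a `ShellMeasureRootComposition`
p207618 and Mathlib's Lebesgue measure) ONLY, modifies nothing; 0 `def`, 0 sorry, 0 cite; the model data are literal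
terms.)

HONEST FRAMING.  Finite four-torus programme, rung (B)+1 only — NOT infinite volume, NOT a mass gap, NOT the Clay
problem, NOT summit progress; (B), `BetaPertHyp`, (B^μ) are not consumed.  NE7c = `T4IndicatorShell.ShellWeightBound`
is NOT PRINTED in [Balaban 1983–89] and NOT PROVED; END-I is the kernel composition «NE7c ⇐ the named binders»
(trigger c3), and THIS FILE IS A FAMILY OF TOYS about END-I's binder SHAPES: nothing of Bałaban's (no term family, no
effective density, no block chart) is instantiated, no estimate of the cell is touched, no binder of the real problem
is discharged; (M1) for Bałaban's inductive measures stays THE wall (GAPS G-ne7cp1-1), located, NOT PRINTED; spine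
PROVED 0/9 before and after.  Every declaration is [folklore] kernel mathematics.  HONEST DEPENDENCY (cell, verbatim):
continuum YM on T⁴ ⇐ BetaPertH ∧ nine spine estimates (0/9 proved); BetaPertH ⇐ (D1) ∧ (D4) ∧ CAP+tail; G-an2-4
gates asym, D1 and NE2/3/4.

WHY THIS FILE.  S10 certifies that END-I's eleven binder kinds — per run (R) `sh_nonneg`∕`sh_le`∕`cover`, the [dict]
constant sign `hM` and PUSHES `piece_le`∕`total_ge`, the signs `hD0`∕`hρ0`, THE WALL (M1) `hac` per slot by level,
and across levels the live window (W1) `hw` (WALL §2 (i), W-g), the level-only majorant `hD : D_j ≤ D̄` (§2 (j),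
SM-L10) and node U1b's RATE `hrate : ρ_j ≤ c₁ϑ^j` (§2 (h), W-f; band twin: `Summable ρ` + age counts) — are JOINTLY
SATISFIABLE by non-degenerate data on which the END fires.  The dual question — is any of them IDLE, i.e. could the
END be re-cut without it? — had no kernel answer.  This file gives it for every binder that is not a field of the
conclusion itself (`sh_nonneg`∕`sh_le` reappear inside `ShellWeightBound`; `hM`∕`hD0`∕`hρ0` are signs): for EACH of
`hac`, `hrate` (resp. `Summable ρ`), `hw`, `hD`, `piece_le`, `total_ge`, `cover` there is a model meeting EVERY OTHER
binder on which `ShellWeightBound l₀ T A B shA shB Wsh` holds for NO `Wsh : ℕ → ℝ` (§1–§2 here, §3–§5 in file 2),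
and on the uniform one-slot model the rate binder is NECESSARY AND SUFFICIENT in the currency `Summable ρ` (§1).  So END-I's hypothesis
list is certified MINIMAL (no idle estimate) as well as CONSISTENT (S10); in particular the by-name inputs W-f (rate,
through summability exactly — «ρ_j → 0» is NOT enough, §1) and W-g (window, file 2 §4), the wall (M1) (§2) and
SM-L10's level-only majorant (file 2 §3) are each indispensable TO END-I AS CUT.
VALUE = a records-grade minimality certificate for the typed frame; it says NOTHING about Bałaban's densities.
THE ENDs OF RECORD.  The abstract END-I of record `ShellMeasureRootCompositionSync.shellWeightBound_of_slotAC_sync`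
(owner ruling T-NE7c-7) has the SAME binder kinds with SLOT-indexed thresholds `θ K s`, END-I above being its
level-indexed special case; every model below uses the constant threshold `1`, so each census is verbatim a census of
that END's binder list as well (read `θ K s := 1`).  The term-family END `…HistoriesSync.shellWeightBound_histories_age`
PROVES the two [dict] pushes from the (2.17)–(2.18) term structure and displays instead the a.e. two-run CLOSENESS
`hclose`; its (M1) ∕ window ∕ `D̄` ∕ rate binders are the kinds treated here, its closeness binder is NOT (a separate
model in its own currency would be needed — not in these two files).

THE MODELS (all on the term data of `T4ShellMeasureLevels.Toy`: one term `()` per step, weight `A ≡ 1`; tested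
variable the identity on `ℝ`, threshold `θ ≡ 1`; run B := run A):
* §0 the generic obstruction: a nonnegative NON-SUMMABLE lower profile `r K · Σ A ≤ Σ shA` at source `t = 0`
  (`0 ≤ l₀`) fits NO `ShellWeightBound` — its `Wsh` would dominate `r` (`relShell_le_of_shellWeightBound`,
  `not_shellWeightBound_of_relShell`); one-term form `not_shellWeightBound_oneTerm` (shell part `= sh K`, not summable)
  and `not_shellWeightBound_full` (shell part = the whole weight).
* §1 UNIFORM ONE-SLOT MODEL, FREE WIDTHS `0 ≤ ρ_j ≤ 1`: the top-level slot of S10 (law `volume↾[0,1]`, [dict]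
  constant `M ≡ 1`, `D ≡ 1`), shell part = piece `= ρ_K`: every per-run binder holds (`unif_*`; (M1) by S10's
  `slotAC_unif`, the pushes with equality), the window is `Toy.liveWindow`, `D_j = 1 ≤ D̄ = 1`; the END's band twin
  FIRES from `Summable ρ` (`unif_shellWeightBound_of_summable`) and conversely any `ShellWeightBound` forces
  `Summable ρ` (§0 with `r = ρ`): **`unif_shellWeightBound_iff`**.  RATE NECESSITY (`harmonic_*`): the harmonic widths
  `ρ_j = 1∕(j+1)` tend to `0`, meet every binder but the rate — `¬ ∃ c₁ ϑ, 0 < ϑ < 1 ∧ ∀ j, ρ_j ≤ c₁ϑ^j` (any such rate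
  would make `ρ` summable) and `¬ Summable ρ` — and the END fails for every `Wsh` (`harmonic_census`).
* §2 (M1) NECESSITY — THE DIRAC-IN-SHELL MODEL: slot law `dirac (1 − ϑ^K∕2)` at step `K` (a unit atom INSIDE the
  level-`K` threshold shell `[1 − ϑ^K, 1)`), widths `ρ_j = ϑ^j` (`0 < ϑ < 1`), `D ≡ 1`, `M ≡ 1`, shell part = piece
  `= 1 = A`: (R), both pushes (with equality), window, `D̄`, geometric rate ALL hold; (M1) FAILS at every step `K ≥ 1`
  (`dirac_not_slotAC`; at `K = 0` it holds, `dirac_slotAC_zero`); the END fails for every `Wsh` (`dirac_census`).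
* FILE 2∕2 `ShellMeasureRootCompositionNecessityLevels` (imports this file): §3 `D_j ≤ D̄` NECESSITY (the Dirac model
  with the exploding constants `D_j := (ϑ^j)⁻¹` — (M1) then HOLDS, `D` is unbounded, the END fails), §4 (W1) NECESSITY
  (a live slot at EVERY level `0 … K`: (M1), pushes, `D̄`, geometric rate hold, `¬ LiveWindow` for every `N₁ ν̄`, the
  END fails — the window is what turns a per-LEVEL rate into a per-STEP one), §5 the [dict] PUSHES `piece_le` ∕
  `total_ge` ∕ `cover` (each dropped in turn, every other binder kept, the END fails).

WHAT THIS DOES NOT DO.  It is not evidence for or against (M1), (W1) or the rate on Bałaban's measures; it changes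
nothing in the countdown; it re-exports no END.
-/

open Finset MeasureTheory Set Filter

namespace Summit.QuantumFields.BalabanUV.T4Continuum.ShellMeasureRootCompositionNecessity

open scoped ENNReal Topology
open Literature.MathematicalPhysics.QuantumFieldTheory.Balaban1983to89
open T4IndicatorShell T4ShellMeasure T4ShellMeasureLevels
open ShellMeasureRootComposition ShellMeasureRootCompositionToy

/-! ## §0 The generic obstruction: a non-summable relative shell profile fits no `ShellWeightBound` -/

section Obstruction

variable {ι : Type*} {l₀ : ℝ} {T : ℕ → Finset ι} {A B shA shB : ℕ → ℝ → ι → ℝ} {Wsh r : ℕ → ℝ}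

/-- If run A's total shell part at source `t = 0` is bounded BELOW by `r K ×` its (positive) total weight, then any
`ShellWeightBound … Wsh` has `r K ≤ Wsh K` at every step (`0 ≤ l₀` makes `t = 0` admissible). [folklore] -/
theorem relShell_le_of_shellWeightBound (h : ShellWeightBound l₀ T A B shA shB Wsh) (hl₀ : 0 ≤ l₀)
    (hA : ∀ K, 0 < ∑ τ ∈ T K, A K 0 τ) (hlow : ∀ K, r K * ∑ τ ∈ T K, A K 0 τ ≤ ∑ τ ∈ T K, shA K 0 τ) (K : ℕ) :
    r K ≤ Wsh K :=
  le_of_mul_le_mul_right ((hlow K).trans (h.left K 0 (by rw [abs_zero]; exact hl₀))) (hA K)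

/-- **THE OBSTRUCTION.**  A nonnegative, NON-SUMMABLE lower profile `r` of run A's relative shell weight at `t = 0`
fits NO `ShellWeightBound` (whatever `Wsh`): `Wsh ≥ r ≥ 0` would be summable. [folklore] -/
theorem not_shellWeightBound_of_relShell (hl₀ : 0 ≤ l₀) (hA : ∀ K, 0 < ∑ τ ∈ T K, A K 0 τ)
    (hlow : ∀ K, r K * ∑ τ ∈ T K, A K 0 τ ≤ ∑ τ ∈ T K, shA K 0 τ) (hr0 : ∀ K, 0 ≤ r K) (hr : ¬ Summable r) :
    ¬ ShellWeightBound l₀ T A B shA shB Wsh :=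
  fun h => hr (Summable.of_nonneg_of_le hr0 (relShell_le_of_shellWeightBound h hl₀ hA hlow) h.summable)

/-- ONE-TERM FORM (term data of `T4ShellMeasureLevels.Toy`: one term of weight `1` per step): if run A's shell part at
step `K` is a `t`-independent number `sh K ≥ 0` and `sh` is NOT summable, no `Wsh` gives a `ShellWeightBound`.
[folklore] -/
theorem not_shellWeightBound_oneTerm (hl₀ : 0 ≤ l₀) {sh : ℕ → ℝ} {shB : ℕ → ℝ → Unit → ℝ} (h0 : ∀ K, 0 ≤ sh K)
    (hns : ¬ Summable sh) (Wsh : ℕ → ℝ) :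
    ¬ ShellWeightBound l₀ Toy.T Toy.A Toy.A (fun K _ _ => sh K) shB Wsh :=
  not_shellWeightBound_of_relShell (r := sh) hl₀ (fun K => by simp [Toy.T, Toy.A])
    (fun K => by simp [Toy.T, Toy.A]) h0 hns

/-- FULL-SHELL FORM: if run A's shell part IS the whole term weight (`shA = A ≡ 1`), no `Wsh` gives a `ShellWeightBound`
(the constant profile `1` is not summable). [folklore] -/
theorem not_shellWeightBound_full (hl₀ : 0 ≤ l₀) {shB : ℕ → ℝ → Unit → ℝ} (Wsh : ℕ → ℝ) :
    ¬ ShellWeightBound l₀ Toy.T Toy.A Toy.A Toy.A shB Wsh :=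
  not_shellWeightBound_oneTerm hl₀ (sh := fun _ => 1) (fun _ => zero_le_one)
    (fun h => one_ne_zero (tendsto_nhds_unique tendsto_const_nhds h.tendsto_atTop_zero)) Wsh

end Obstruction

/-! ## §1 The uniform one-slot model with FREE widths: every binder, the END from `Summable ρ`, and the converse -/

section Uniform

variable {ρ : ℕ → ℝ} (l₀ : ℝ)

/-- (R) `sh_nonneg` on the model: the shell part `ρ_K` is nonnegative. [folklore] -/
theorem unif_sh_nonneg (h0 : ∀ j, 0 ≤ ρ j) :
    ∀ K (t : ℝ), |t| ≤ l₀ → ∀ τ ∈ Toy.T K, 0 ≤ (fun K (_ : ℝ) (_ : Unit) => ρ K) K t τ :=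
  fun K _ _ _ _ => h0 K

/-- (R) `sh_le` on the model: the shell part `ρ_K ≤ 1 = A`. [folklore] -/
theorem unif_sh_le (h1 : ∀ j, ρ j ≤ 1) :
    ∀ K (t : ℝ), |t| ≤ l₀ → ∀ τ ∈ Toy.T K, (fun K (_ : ℝ) (_ : Unit) => ρ K) K t τ ≤ Toy.A K t τ :=
  fun K _ _ _ _ => h1 K

/-- (R) `cover` on the model: the shell part is the one slot's piece. [folklore] -/
theorem unif_cover : ∀ K (t : ℝ), |t| ≤ l₀ → ∀ τ ∈ Toy.T K,
    (fun K (_ : ℝ) (_ : Unit) => ρ K) K t τ ≤ ∑ s ∈ Toy.S K, (fun K (_ : ℝ) (_ : Unit) (_ : Unit) => ρ K) K t s τ :=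
  fun K _ _ _ _ => by simp [Toy.S]

/-- [dict] PUSH `piece_le` on the model, WITH EQUALITY: the piece `ρ_K` weighs `1 ×` the uniform mass `ρ_K` of the
level-`K` threshold shell `[1 − ρ_K, 1)` (`0 ≤ ρ_K ≤ 1`). [folklore] -/
theorem unif_piece_le (h0 : ∀ j, 0 ≤ ρ j) (h1 : ∀ j, ρ j ≤ 1) :
    ∀ K (t : ℝ), |t| ≤ l₀ → ∀ s ∈ Toy.S K, ∑ τ ∈ Toy.T K, (fun K (_ : ℝ) (_ : Unit) (_ : Unit) => ρ K) K t s τ ≤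
      1 * ((volume.restrict (Icc (0 : ℝ) 1))
        {y : ℝ | 1 * (1 - ρ (Toy.lvl K s)) ≤ (fun y : ℝ => y) y ∧ (fun y : ℝ => y) y < 1}).toReal := by
  intro K t _ s _
  show ∑ τ ∈ Toy.T K, ρ K ≤ 1 * ((volume.restrict (Icc (0 : ℝ) 1)) {y : ℝ | 1 * (1 - ρ K) ≤ y ∧ y < 1}).toReal
  rw [unif_shell (h1 K), ENNReal.toReal_ofReal (h0 K)]
  simp [Toy.T]

/-- THE WALL (M1) on the model (binder `hac`): the uniform law is anti-concentrated at threshold `1`, width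
`ρ_K ≤ 1`, constant `D_K = 1` — S10's `slotAC_unif` BY NAME. [folklore] -/
theorem unif_slotAC (h1 : ∀ j, ρ j ≤ 1) : ∀ K (t : ℝ), |t| ≤ l₀ → ∀ s ∈ Toy.S K,
    SlotAntiConcentration (volume.restrict (Icc (0 : ℝ) 1)) (fun y : ℝ => y) 1 (ρ (Toy.lvl K s))
      (Toy.D (Toy.lvl K s)) :=
  fun K _ _ _ _ => slotAC_unif (h1 K)

/-- **THE END'S BAND TWIN FIRES ON THE MODEL FROM `Summable ρ`** (`shellWeightBound_of_slotAC_band`, age counts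
`m ≡ 1` by S10's `toy_ageCount`, window `Toy.liveWindow`, `D̄ = 1`; both runs = the model): for widths
`0 ≤ ρ_j ≤ 1` with `Summable ρ`, `ShellWeightBound l₀ Toy.T Toy.A Toy.A sh sh (K ↦ Σ_s 1·ρ_K + Σ_s 1·ρ_K)`.
[folklore] -/
theorem unif_shellWeightBound_of_summable (h0 : ∀ j, 0 ≤ ρ j) (h1 : ∀ j, ρ j ≤ 1) (hs : Summable ρ) :
    ShellWeightBound l₀ Toy.T Toy.A Toy.A (fun K _ _ => ρ K) (fun K _ _ => ρ K)
      (fun K => ∑ s ∈ Toy.S K, Toy.D (Toy.lvl K s) * ρ (Toy.lvl K s) +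
        ∑ s ∈ Toy.S K, Toy.D (Toy.lvl K s) * ρ (Toy.lvl K s)) :=
  shellWeightBound_of_slotAC_band (ΩA := fun _ _ => ℝ) (ΩB := fun _ _ => ℝ)
    (pieceA := fun K _ _ _ => ρ K) (pieceB := fun K _ _ _ => ρ K)
    (μA := fun _ _ _ => volume.restrict (Icc (0 : ℝ) 1)) (μB := fun _ _ _ => volume.restrict (Icc (0 : ℝ) 1))
    (uA := fun _ _ _ y => y) (uB := fun _ _ _ y => y) (θA := fun _ => 1) (θB := fun _ => 1)
    (MA := fun _ _ _ => 1) (MB := fun _ _ _ => 1) (N₁ := 0) (νbar := 1) (Dbar := 1) (m := fun _ => 1)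
    (unif_sh_nonneg l₀ h0) (unif_sh_le l₀ h1) (unif_cover l₀) (toy_M_nonneg l₀) (unif_piece_le l₀ h0 h1)
    (toy_total_ge l₀) (fun _ => zero_le_one) h0 (unif_slotAC l₀ h1)
    (unif_sh_nonneg l₀ h0) (unif_sh_le l₀ h1) (unif_cover l₀) (toy_M_nonneg l₀) (unif_piece_le l₀ h0 h1)
    (toy_total_ge l₀) (fun _ => zero_le_one) h0 (unif_slotAC l₀ h1)
    Toy.liveWindow Toy.liveWindow toy_D_le toy_D_le toy_ageCount toy_ageCount hs hs

variable {l₀}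

/-- **SHARPNESS OF THE RATE BINDER ON THE UNIFORM MODEL**: for widths `0 ≤ ρ_j ≤ 1` and `0 ≤ l₀`, the model's term
data admit SOME `ShellWeightBound` IFF `Summable ρ` — sufficiency is END-I's band twin, necessity is §0 (the model's
relative shell weight at step `K` is EXACTLY `ρ_K`).  So END-I's rate input (node U1b's `ρ_j ≤ c₁ϑ^j`, or the band
twin's `Summable ρ`) is load-bearing precisely through SUMMABILITY; a geometric rate is one sufficient instance.
[folklore] -/
theorem unif_shellWeightBound_iff (hl₀ : 0 ≤ l₀) (h0 : ∀ j, 0 ≤ ρ j) (h1 : ∀ j, ρ j ≤ 1) :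
    (∃ Wsh : ℕ → ℝ, ShellWeightBound l₀ Toy.T Toy.A Toy.A (fun K _ _ => ρ K) (fun K _ _ => ρ K) Wsh) ↔
      Summable ρ := by
  constructor
  · rintro ⟨Wsh, h⟩
    by_contra hns
    exact not_shellWeightBound_oneTerm hl₀ h0 hns Wsh h
  · exact fun hs => ⟨_, unif_shellWeightBound_of_summable l₀ h0 h1 hs⟩

/-! ### RATE NECESSITY: the harmonic widths `ρ_j = 1∕(j+1)` -/

/-- the harmonic widths `1∕(j+1)` lie in `(0, 1]` (admissible widths of the uniform model). [folklore] -/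
theorem harmonic_mem_Ioc (j : ℕ) : 1 / ((j : ℝ) + 1) ∈ Set.Ioc (0 : ℝ) 1 := by
  refine ⟨one_div_pos.2 (Nat.cast_add_one_pos j), ?_⟩
  rw [div_le_one (Nat.cast_add_one_pos j)]
  linarith [(Nat.cast_nonneg j : (0 : ℝ) ≤ j)]

/-- the harmonic widths TEND TO ZERO … [folklore] -/
theorem harmonic_tendsto_zero : Tendsto (fun j : ℕ => 1 / ((j : ℝ) + 1)) atTop (𝓝 0) :=
  tendsto_one_div_add_atTop_nhds_zero_nat

/-- … but are NOT SUMMABLE. [folklore] -/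
theorem harmonic_not_summable : ¬ Summable (fun j : ℕ => 1 / ((j : ℝ) + 1)) := by
  intro hs
  have h' : Summable (fun n : ℕ => 1 / ((n + 1 : ℕ) : ℝ)) := by
    simpa [Nat.cast_add, Nat.cast_one] using hs
  exact Real.not_summable_one_div_natCast ((summable_nat_add_iff 1).1 h')

/-- **THE RATE BINDER FAILS for the harmonic widths — and ONLY because a geometric rate would force summability**:
there are NO `c₁`, `0 < ϑ < 1` with `1∕(j+1) ≤ c₁ϑ^j` for all `j`. [folklore] -/
theorem harmonic_not_rate : ¬ ∃ c₁ ϑ : ℝ, 0 < ϑ ∧ ϑ < 1 ∧ ∀ j : ℕ, 1 / ((j : ℝ) + 1) ≤ c₁ * ϑ ^ j := by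
  rintro ⟨c₁, ϑ, hϑ0, hϑ1, h⟩
  exact harmonic_not_summable (Summable.of_nonneg_of_le (fun j => (harmonic_mem_Ioc j).1.le) h
    ((summable_geometric_of_lt_one hϑ0.le hϑ1).mul_left c₁))

/-- **RATE NECESSITY CENSUS.**  On the uniform one-slot model with the harmonic widths `ρ_j = 1∕(j+1)` (`0 ≤ l₀`)
EVERY binder of END-I `shellWeightBound_of_slotAC` except the rate holds — (R) `sh_nonneg`∕`sh_le`∕`cover`, [dict]
`hM`∕`piece_le`∕`total_ge`, `hD0`∕`hρ0`, THE WALL (M1) `hac`, the window (W1) (`N₁ = 0`, `ν̄ = 1`), `D_j ≤ D̄ = 1`,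
and for the band twin the age counts `m ≡ 1` —, the widths even tend to `0`, YET the rate binder is uninhabited for
every `c₁ ϑ`, `ρ` is not summable, and `ShellWeightBound` FAILS FOR EVERY `Wsh`. [folklore] -/
theorem harmonic_census (hl₀ : 0 ≤ l₀) :
    (∀ K (t : ℝ), |t| ≤ l₀ → ∀ τ ∈ Toy.T K, 0 ≤ (fun K (_ : ℝ) (_ : Unit) => 1 / ((K : ℝ) + 1)) K t τ) ∧
    (∀ K (t : ℝ), |t| ≤ l₀ → ∀ τ ∈ Toy.T K, (fun K (_ : ℝ) (_ : Unit) => 1 / ((K : ℝ) + 1)) K t τ ≤ Toy.A K t τ) ∧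
    (∀ K (t : ℝ), |t| ≤ l₀ → ∀ τ ∈ Toy.T K, (fun K (_ : ℝ) (_ : Unit) => 1 / ((K : ℝ) + 1)) K t τ ≤
      ∑ s ∈ Toy.S K, (fun K (_ : ℝ) (_ : Unit) (_ : Unit) => 1 / ((K : ℝ) + 1)) K t s τ) ∧
    (∀ K (t : ℝ), |t| ≤ l₀ → ∀ s ∈ Toy.S K, (0 : ℝ) ≤ 1) ∧
    (∀ K (t : ℝ), |t| ≤ l₀ → ∀ s ∈ Toy.S K,
      ∑ τ ∈ Toy.T K, (fun K (_ : ℝ) (_ : Unit) (_ : Unit) => 1 / ((K : ℝ) + 1)) K t s τ ≤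
        1 * ((volume.restrict (Icc (0 : ℝ) 1)) {y : ℝ | 1 * (1 - 1 / (((Toy.lvl K s : ℕ) : ℝ) + 1)) ≤
          (fun y : ℝ => y) y ∧ (fun y : ℝ => y) y < 1}).toReal) ∧
    (∀ K (t : ℝ), |t| ≤ l₀ → ∀ s ∈ Toy.S K,
      1 * ((volume.restrict (Icc (0 : ℝ) 1)) (univ : Set ℝ)).toReal ≤ ∑ τ ∈ Toy.T K, Toy.A K t τ) ∧
    (∀ j, 0 ≤ Toy.D j) ∧ (∀ j : ℕ, 0 ≤ 1 / ((j : ℝ) + 1)) ∧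
    (∀ K (t : ℝ), |t| ≤ l₀ → ∀ s ∈ Toy.S K, SlotAntiConcentration (volume.restrict (Icc (0 : ℝ) 1))
      (fun y : ℝ => y) 1 (1 / (((Toy.lvl K s : ℕ) : ℝ) + 1)) (Toy.D (Toy.lvl K s))) ∧
    LiveWindow Toy.S Toy.lvl 0 1 ∧ (∀ j, Toy.D j ≤ (1 : ℝ)) ∧
    (∀ K, ∀ a ≤ (0 : ℕ), ((((Toy.S K).filter fun s => K - Toy.lvl K s = a).card : ℕ) : ℝ) ≤ 1) ∧
    Tendsto (fun j : ℕ => 1 / ((j : ℝ) + 1)) atTop (𝓝 0) ∧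
    (¬ ∃ c₁ ϑ : ℝ, 0 < ϑ ∧ ϑ < 1 ∧ ∀ j : ℕ, 1 / ((j : ℝ) + 1) ≤ c₁ * ϑ ^ j) ∧
    ¬ Summable (fun j : ℕ => 1 / ((j : ℝ) + 1)) ∧
    ∀ Wsh : ℕ → ℝ, ¬ ShellWeightBound l₀ Toy.T Toy.A Toy.A (fun K _ _ => 1 / ((K : ℝ) + 1))
      (fun K _ _ => 1 / ((K : ℝ) + 1)) Wsh :=
  ⟨unif_sh_nonneg l₀ (ρ := fun j => 1 / ((j : ℝ) + 1)) fun j => (harmonic_mem_Ioc j).1.le,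
    unif_sh_le l₀ (ρ := fun j => 1 / ((j : ℝ) + 1)) (fun j => (harmonic_mem_Ioc j).2),
    unif_cover l₀ (ρ := fun j => 1 / ((j : ℝ) + 1)), toy_M_nonneg l₀,
    unif_piece_le l₀ (ρ := fun j => 1 / ((j : ℝ) + 1)) (fun j => (harmonic_mem_Ioc j).1.le)
      fun j => (harmonic_mem_Ioc j).2,
    toy_total_ge l₀, fun _ => zero_le_one, fun j => (harmonic_mem_Ioc j).1.le,
    unif_slotAC l₀ (ρ := fun j => 1 / ((j : ℝ) + 1)) fun j => (harmonic_mem_Ioc j).2, Toy.liveWindow, toy_D_le,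
    toy_ageCount,
    harmonic_tendsto_zero, harmonic_not_rate, harmonic_not_summable,
    fun Wsh => not_shellWeightBound_oneTerm hl₀ (sh := fun j => 1 / ((j : ℝ) + 1))
      (fun j => (harmonic_mem_Ioc j).1.le) harmonic_not_summable Wsh⟩

end Uniform

/-! ## §2 (M1) NECESSITY: the Dirac-in-shell model -/

section Dirac

variable {ϑ : ℝ} (l₀ : ℝ)

/-- the atom `1 − ϑ^K∕2` lies INSIDE the level-`K` threshold shell `[1 − ϑ^K, 1)` (`0 < ϑ`). [folklore] -/
theorem atom_mem_shell (h0 : 0 < ϑ) (K : ℕ) :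
    1 - ϑ ^ K / 2 ∈ {y : ℝ | 1 * (1 - ϑ ^ K) ≤ y ∧ y < 1} := by
  have hK : 0 < ϑ ^ K := pow_pos h0 K
  simp only [mem_setOf_eq]
  constructor <;> linarith

/-- the Dirac slot law gives the threshold shell FULL mass `1`. [folklore] -/
theorem dirac_shell (h0 : 0 < ϑ) (K : ℕ) :
    (Measure.dirac (1 - ϑ ^ K / 2)) {y : ℝ | 1 * (1 - ϑ ^ K) ≤ y ∧ y < 1} = 1 :=
  Measure.dirac_apply_of_mem (atom_mem_shell h0 K)

/-- [dict] PUSH `piece_le` on the Dirac model, WITH EQUALITY: the piece `1` weighs `1 ×` the shell mass `1`.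
[folklore] -/
theorem dirac_piece_le (h0 : 0 < ϑ) : ∀ K (t : ℝ), |t| ≤ l₀ → ∀ s ∈ Toy.S K,
    ∑ τ ∈ Toy.T K, (fun (_ : ℕ) (_ : ℝ) (_ : Unit) (_ : Unit) => (1 : ℝ)) K t s τ ≤
      1 * ((Measure.dirac (1 - ϑ ^ K / 2))
        {y : ℝ | 1 * (1 - Toy.ρ ϑ (Toy.lvl K s)) ≤ (fun y : ℝ => y) y ∧ (fun y : ℝ => y) y < 1}).toReal := by
  intro K t _ s _
  show ∑ τ ∈ Toy.T K, (1 : ℝ) ≤ 1 * ((Measure.dirac (1 - ϑ ^ K / 2)) {y : ℝ | 1 * (1 - ϑ ^ K) ≤ y ∧ y < 1}).toReal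
  rw [dirac_shell h0 K]
  simp [Toy.T]

/-- [dict] PUSH `total_ge` on the Dirac model, WITH EQUALITY: `1 ×` the total mass `1` is the term weight `1`.
[folklore] -/
theorem dirac_total_ge : ∀ K (t : ℝ), |t| ≤ l₀ → ∀ s ∈ Toy.S K,
    1 * ((Measure.dirac (1 - ϑ ^ K / 2)) (univ : Set ℝ)).toReal ≤ ∑ τ ∈ Toy.T K, Toy.A K t τ := by
  intro K t _ s _
  rw [measure_univ]
  simp [Toy.T, Toy.A]

/-- (R) `cover` on the Dirac model: the shell part `1` is the one slot's piece `1`. [folklore] -/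
theorem dirac_cover : ∀ K (t : ℝ), |t| ≤ l₀ → ∀ τ ∈ Toy.T K,
    Toy.A K t τ ≤ ∑ s ∈ Toy.S K, (fun (_ : ℕ) (_ : ℝ) (_ : Unit) (_ : Unit) => (1 : ℝ)) K t s τ :=
  fun K _ _ _ _ => by simp [Toy.S, Toy.A]

/-- **(M1) FAILS ON THE DIRAC MODEL** at every step `K ≥ 1` (`0 < ϑ < 1`, constant `D = 1`): the shell carries the
atom's full mass `1 > ϑ^K·1`. [folklore] -/
theorem dirac_not_slotAC (h0 : 0 < ϑ) (h1 : ϑ < 1) {K : ℕ} (hK : K ≠ 0) :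
    ¬ SlotAntiConcentration (Measure.dirac (1 - ϑ ^ K / 2)) (fun y : ℝ => y) 1 (Toy.ρ ϑ (Toy.lvl K ()))
      (Toy.D (Toy.lvl K ())) := by
  show ¬ ((Measure.dirac (1 - ϑ ^ K / 2)) {y : ℝ | 1 * (1 - ϑ ^ K) ≤ y ∧ y < 1} ≤
    ENNReal.ofReal (1 * ϑ ^ K) * (Measure.dirac (1 - ϑ ^ K / 2)) (univ : Set ℝ))
  rw [dirac_shell h0 K, measure_univ, mul_one, one_mul, not_le, ENNReal.ofReal_lt_one]
  exact pow_lt_one₀ h0.le h1 hK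

/-- … and the restriction `K ≥ 1` is SHARP: at step `0` the width is `ϑ^0 = 1`, the threshold shell is all of `[0, 1)`
and (M1) HOLDS on the Dirac model (any `ϑ`). [folklore] -/
theorem dirac_slotAC_zero (ϑ : ℝ) :
    SlotAntiConcentration (Measure.dirac (1 - ϑ ^ 0 / 2)) (fun y : ℝ => y) 1 (Toy.ρ ϑ (Toy.lvl 0 ()))
      (Toy.D (Toy.lvl 0 ())) := by
  show (Measure.dirac (1 - ϑ ^ 0 / 2)) {y : ℝ | 1 * (1 - ϑ ^ 0) ≤ y ∧ y < 1} ≤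
    ENNReal.ofReal (1 * ϑ ^ 0) * (Measure.dirac (1 - ϑ ^ 0 / 2)) (univ : Set ℝ)
  simp only [pow_zero, one_mul, ENNReal.ofReal_one, measure_univ, mul_one]
  exact prob_le_one

/-- **(M1) NECESSITY CENSUS.**  On the Dirac-in-shell model (`0 < ϑ < 1`, `0 ≤ l₀`; shell part = piece `= 1 = A`,
widths `ρ_j = ϑ^j`, `D ≡ 1`, `M ≡ 1`) EVERY binder of END-I except (M1) holds — (R), [dict] `hM`∕`piece_le`∕`total_ge`
(the pushes with equality), `hD0`∕`hρ0`, the window (`N₁ = 0`, `ν̄ = 1`), `D_j ≤ D̄ = 1`, the geometric rate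
(`c₁ = 1`) —, (M1) FAILS at every step `K ≥ 1`, and `ShellWeightBound` FAILS FOR EVERY `Wsh`. [folklore] -/
theorem dirac_census (hl₀ : 0 ≤ l₀) (h0 : 0 < ϑ) (h1 : ϑ < 1) :
    (∀ K (t : ℝ), |t| ≤ l₀ → ∀ τ ∈ Toy.T K, 0 ≤ Toy.A K t τ) ∧
    (∀ K (t : ℝ), |t| ≤ l₀ → ∀ τ ∈ Toy.T K, Toy.A K t τ ≤ Toy.A K t τ) ∧
    (∀ K (t : ℝ), |t| ≤ l₀ → ∀ τ ∈ Toy.T K,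
      Toy.A K t τ ≤ ∑ s ∈ Toy.S K, (fun (_ : ℕ) (_ : ℝ) (_ : Unit) (_ : Unit) => (1 : ℝ)) K t s τ) ∧
    (∀ K (t : ℝ), |t| ≤ l₀ → ∀ s ∈ Toy.S K, (0 : ℝ) ≤ 1) ∧
    (∀ K (t : ℝ), |t| ≤ l₀ → ∀ s ∈ Toy.S K,
      ∑ τ ∈ Toy.T K, (fun (_ : ℕ) (_ : ℝ) (_ : Unit) (_ : Unit) => (1 : ℝ)) K t s τ ≤
        1 * ((Measure.dirac (1 - ϑ ^ K / 2))
          {y : ℝ | 1 * (1 - Toy.ρ ϑ (Toy.lvl K s)) ≤ (fun y : ℝ => y) y ∧ (fun y : ℝ => y) y < 1}).toReal) ∧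
    (∀ K (t : ℝ), |t| ≤ l₀ → ∀ s ∈ Toy.S K,
      1 * ((Measure.dirac (1 - ϑ ^ K / 2)) (univ : Set ℝ)).toReal ≤ ∑ τ ∈ Toy.T K, Toy.A K t τ) ∧
    (∀ j, 0 ≤ Toy.D j) ∧ (∀ j, 0 ≤ Toy.ρ ϑ j) ∧
    LiveWindow Toy.S Toy.lvl 0 1 ∧ (∀ j, Toy.D j ≤ (1 : ℝ)) ∧ (∀ j, Toy.ρ ϑ j ≤ 1 * ϑ ^ j) ∧
    (∀ K ≠ 0, ¬ SlotAntiConcentration (Measure.dirac (1 - ϑ ^ K / 2)) (fun y : ℝ => y) 1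
      (Toy.ρ ϑ (Toy.lvl K ())) (Toy.D (Toy.lvl K ()))) ∧
    ∀ Wsh : ℕ → ℝ, ¬ ShellWeightBound l₀ Toy.T Toy.A Toy.A Toy.A Toy.A Wsh :=
  ⟨fun _ _ _ _ _ => zero_le_one, fun _ _ _ _ _ => le_rfl, dirac_cover l₀, toy_M_nonneg l₀, dirac_piece_le l₀ h0,
    dirac_total_ge l₀, fun _ => zero_le_one, fun j => pow_nonneg h0.le j, Toy.liveWindow, toy_D_le,
    toy_rate h0.le le_rfl, fun _ hK => dirac_not_slotAC h0 h1 hK, not_shellWeightBound_full hl₀⟩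

end Dirac

end Summit.QuantumFields.BalabanUV.T4Continuum.ShellMeasureRootCompositionNecessity
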